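import Literature.AlgebraicGeometry.Modules.PushforwardBaseChangeCharts
import Literature.AlgebraicGeometry.Modules.PullbackSectionsBaseChange
import Literature.AlgebraicGeometry.Modules.PushforwardClosedImmersionCoh
import HarnessLib

/-!
# Affine base change: `b^* p_* G ≅ p_{T*} pr^* G` for `p` affine and `G` quasi-coherent (Stacks 02KG)

Topic `Literature/AlgebraicGeometry/Modules`; theorems only (no definition, no named fact, no instance, no `sorry`).
Cell hodgecm-mathlib, F-DAG (h6-d)/(h2): the UNCONDITIONAL case of the «cohomology commutes with base change in degree 0»
socket (hbc) — for an AFFINE morphism `p` no flatness or vanishing is needed.  HC_CM is proved only modulo the 7 printed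
citations until rung 0 closes; nothing here is about HC.

For a CARTESIAN square of schemes
```
X_T —pr→ X
 |pT      |p
 T  —b—→  S
```
with `p` AFFINE and an affine-localizing (= quasi-coherent, ★ `isQuasicoherent_iff_isAffineLocalizing`) `𝒪_X`-module `G`,
the module-level base-change morphism `β : b^*(p_*G) ⟶ pT_*(pr^*G)` of ★ `Modules/PushforwardBaseChangeHom`
(`pushforwardBaseChangeHom`) is an ISOMORPHISM ([StacksProject, Tag 02KG]; [Hartshorne1977] III Prop. 9.3 for flat `b`,
here for any `b` since `p` is affine).  Proof: ★ `PushforwardBaseChangeCharts.isIso_pushforwardBaseChangeHom_of_charts`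
reduces to affine charts `V ⊆ S`, `W ⊆ b⁻¹V`, where `p⁻¹V` is affine (`p` affine) and ★
`PullbackSectionsBaseChange.exists_linearEquiv_tensor_sections_pullback` IS the required chart isomorphism
`Γ(W) ⊗_{Γ(V)} Γ(G, p⁻¹V) ≅ Γ(pr^*G, pT⁻¹W)`, `t ⊗ s ↦ t · η_{pr}(s)|` (the `𝒪_S(V)`-module structure on
`Γ(p_*G, V) = Γ(G, p⁻¹V)` being the one through `p♯`, Mathlib `Scheme.Modules.pushforward` — definitional).

* `isIso_pushforwardBaseChangeHom_of_isAffineHom` — the theorem; `…_of_isFinite` (finite `p`), `mono_…` (the (hbc) input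
  of ★ `Morphisms/ContainmentRepOfPushforward` for affine `p`).

## References
* [StacksProject] The Stacks Project, Tag 02KG (Cohomology of Schemes, Lemma 30.5.1: affine base change), Tag 02KE.
* [Hartshorne1977] R. Hartshorne, *Algebraic Geometry* (1977), III Prop. 9.3 (p. 255) (flat base change; the affine-chart
  reduction in its proof), II Prop. 5.8 (p. 115).
* [GortzWedhorn2020] U. Görtz, T. Wedhorn, *Algebraic Geometry I: Schemes*, 2nd ed. (2020), Proposition 12.6 (1)
  («Let the diagram (12.2.1) be cartesian … (1) f is affine … Then the homomorphism (12.2.3) is an isomorphism»).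
-/

noncomputable section

-- `TopCat.Presheaf`/`Scheme.Modules` are not reducible (as in Mathlib's `AlgebraicGeometry/Modules`).
set_option backward.isDefEq.respectTransparency false

open CategoryTheory CategoryTheory.Limits AlgebraicGeometry TopologicalSpace Opposite TensorProduct

universe u

namespace Literature.AlgebraicGeometry.Modules

variable {X S T XT : Scheme.{u}} {pr : XT ⟶ X} {pT : XT ⟶ T} {p : X ⟶ S} {b : T ⟶ S}
  (H : IsPullback pr pT p b) (G : X.Modules)

/-- **AFFINE BASE CHANGE** ([StacksProject, Tag 02KG]): for a cartesian square `pr ≫ p = pT ≫ b` with `p` AFFINE and `G` an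
affine-localizing (quasi-coherent) `𝒪_X`-module, the base-change morphism `b^*(p_*G) ⟶ pT_*(pr^*G)` is an isomorphism —
for ANY `b`. [cite: StacksProject, Tag 02KG] [cite: GortzWedhorn2020, Proposition 12.6 (1)]
[cite: Hartshorne1977, III Prop. 9.3 (p. 255)] -/
theorem isIso_pushforwardBaseChangeHom_of_isAffineHom [IsAffineHom p] (hG : IsAffineLocalizing G) :
    IsIso (pushforwardBaseChangeHom H.w G) := by
  refine isIso_pushforwardBaseChangeHom_of_charts H.w G (isAffineLocalizing_pushforward_of_isAffineHom p hG) ?_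
  intro V hV W hW i
  letI : Algebra Γ(S, V) Γ(T, W) := (b.appLE V W i).hom.toAlgebra
  -- the chart `pT⁻¹W = pr⁻¹(p⁻¹V) ∩ pT⁻¹W` of `X_T` over the affine `p⁻¹V`
  have hle : pT ⁻¹ᵁ W ≤ pr ⁻¹ᵁ (p ⁻¹ᵁ V) :=
    (Scheme.Hom.preimage_mono pT i).trans (preimage_preimage_eq_of_sq H.w V).ge
  have hUY : pT ⁻¹ᵁ W = pr ⁻¹ᵁ (p ⁻¹ᵁ V) ⊓ pT ⁻¹ᵁ W := (inf_eq_right.mpr hle).symm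
  -- the `Γ(S, V)`-module `Γ(G, p⁻¹V) = Γ(p_*G, V)` and the `Γ(T, W)`-module `Γ(pr^*G, pT⁻¹W) = Γ(pT_*(pr^*G), W)`
  letI : Module Γ(S, V) Γ(G, p ⁻¹ᵁ V) :=
    (inferInstance : Module Γ(S, V) Γ((Scheme.Modules.pushforward p).obj G, V))
  letI : Module Γ(T, W) Γ((Scheme.Modules.pullback pr).obj G, pT ⁻¹ᵁ W) :=
    (inferInstance : Module Γ(T, W) Γ((Scheme.Modules.pushforward pT).obj ((Scheme.Modules.pullback pr).obj G), W))
  have hiX : ∀ (r : Γ(S, V)) (m : Γ(G, p ⁻¹ᵁ V)), r • m = p.appLE V (p ⁻¹ᵁ V) le_rfl r • m := fun r m => by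
    rw [Scheme.Hom.appLE_eq_app]
    rfl
  have hiY : ∀ (t : Γ(T, W)) (n : Γ((Scheme.Modules.pullback pr).obj G, pT ⁻¹ᵁ W)),
      t • n = pT.appLE W (pT ⁻¹ᵁ W) (le_preimage_right_of_eq_inf hUY) t • n := fun t n => by
    rw [show pT.appLE W (pT ⁻¹ᵁ W) (le_preimage_right_of_eq_inf hUY) = pT.app W from Scheme.Hom.appLE_eq_app _]
    rfl
  obtain ⟨e, he⟩ := exists_linearEquiv_tensor_sections_pullback H hV hW (hV.preimage p) i le_rfl hUY G hG rfl hiX hiY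
  exact ⟨e, fun t s => he t s⟩

/-- Affine base change for a FINITE morphism (finite ⇒ affine; GW I: «If f is finite, the formation of `f_*𝒪_X`
commutes with base change by Proposition 12.6»). [cite: StacksProject, Tag 02KG] [cite: GortzWedhorn2020, Proposition 12.6 (1)] -/
theorem isIso_pushforwardBaseChangeHom_of_isFinite [IsFinite p] (hG : IsAffineLocalizing G) :
    IsIso (pushforwardBaseChangeHom H.w G) :=
  isIso_pushforwardBaseChangeHom_of_isAffineHom H G hG

/-- The (hbc) socket of ★ `Morphisms/ContainmentRepOfPushforward` for affine `p`: the base-change morphism is a monomorphism.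
[cite: StacksProject, Tag 02KG] -/
theorem mono_pushforwardBaseChangeHom_of_isAffineHom [IsAffineHom p] (hG : IsAffineLocalizing G) :
    Mono (pushforwardBaseChangeHom H.w G) :=
  haveI := isIso_pushforwardBaseChangeHom_of_isAffineHom H G hG
  inferInstance

end Literature.AlgebraicGeometry.Modules

end
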